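import Summits.ABC.ABC.Theorems.RibetTakahashiSplitWeightedSzpiroBoundAbc

/-!
# Crux `ThinWeightedSzpiro` (stmt-ABC-17927) — ideator 1, round 1: SELF-IMPROVEMENT SPLIT

Sketch file for the crux idea card `thin-self-improvement` (planner-cruxidea-stmt-ABC-17927-1-0).

The crux r3″ = `RibetTakahashiSplit.ThinWeightedSzpiro` freezes the class exponent `θ` BEFORE `∀ ε`.
We record, over the crux's own vocabulary, the two statements it splits into and the glue:

* `PolyThinH θ A`  — POLYNOMIAL generalized Szpiro (any exponent `A`) on the `θ`-thin class;
* `Upgrade A`      — SHARP weighted Szpiro on the polynomial window `H ≤ K·N^A`, with NO thinness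
                     hypothesis at all (thinness is automatic there by the divisor bound);
* `crux_of_polyThinH_of_upgrade : 0 < θ → PolyThinH θ A → Upgrade A → ThinWeightedSzpiro` (10 lines of
  logic) and the converses `polyThinH_of_crux`, `upgrade_of_crux`, whence `crux_iff`.

So the thin-class crux is EXACTLY "polynomial Szpiro on thin curves" ∧ "exponent upgrade on the
polynomial window"; only the first conjunct can use thinness.  Also recorded: the quantifier-repaired
form `SlidingThin` (`∀ ε ∃ δ`) and the fudge-free form `FudgeFree B` (free `T`-exponent).
-/

noncomputable section

set_option linter.dupNamespace false

namespace Summit.ABC.ABC.Cruxes.ThinWeightedSzpiro.SelfImprovement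

open Summit.ABC.ABC.Theses.RibetTakahashiSplit
open Summit.ABC.ABC.Theorems
open IsDedekindDomain

/-- The component-order weight `T(W₀) = ∏_{p ∥ N} ord_p(Δ_min)` of the crux (verbatim its subterm). -/
abbrev tamWeight (W₀ : WeierstrassCurve ℤ) : ℕ :=
  ∏ p ∈ ((W₀.baseChange ℚ).conductorNorm ℤ).primeFactors with
      ¬ p ^ 2 ∣ (W₀.baseChange ℚ).conductorNorm ℤ,
    ((W₀.baseChange ℚ).minimalDiscriminantNorm ℤ).factorization p

/-- The conductor `N` as a real number (verbatim the crux's subterm). -/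
abbrev condR (W₀ : WeierstrassCurve ℤ) : ℝ := (((W₀.baseChange ℚ).conductorNorm ℤ : ℕ) : ℝ)

/-- The naive height `H = max(|Δ(W₀)|, |c₄(W₀)|³)` as a real number (verbatim the crux's subterm). -/
abbrev heightH (W₀ : WeierstrassCurve ℤ) : ℝ := ((max |W₀.Δ| (|W₀.c₄| ^ 3) : ℤ) : ℝ)

/-- **PolyThinH θ A** — polynomial generalized Szpiro, exponent `A`, on the `θ`-thin class of global
minimal models semistable away from `2`: `T ≤ K N^θ ⟹ H ≤ C(K) N^A`. -/
def PolyThinH (θ A : ℝ) : Prop :=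
  ∀ K : ℝ, ∃ C : ℝ, ∀ W₀ : WeierstrassCurve ℤ, (W₀.baseChange ℚ).IsElliptic →
    (∀ v : HeightOneSpectrum ℤ, (W₀.baseChange ℚ).IsMinimalAt v) →
    (∀ p : ℕ, p.Prime → p ≠ 2 → ¬ p ^ 2 ∣ (W₀.baseChange ℚ).conductorNorm ℤ) →
    (tamWeight W₀ : ℝ) ≤ K * condR W₀ ^ θ →
    heightH W₀ ≤ C * condR W₀ ^ A

/-- **Upgrade A** — exponent upgrade on the polynomial window: every global minimal model semistable
away from `2` with `H ≤ K N^A` satisfies the sharp weighted bound `H ≤ C (N·T)^{6+ε}`.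
NO thinness hypothesis: on this window `T ≤ K_η H^η ≤ K' N^{Aη}` is automatic. -/
def Upgrade (A : ℝ) : Prop :=
  ∀ ε : ℝ, 0 < ε → ∀ K : ℝ, ∃ C : ℝ, ∀ W₀ : WeierstrassCurve ℤ, (W₀.baseChange ℚ).IsElliptic →
    (∀ v : HeightOneSpectrum ℤ, (W₀.baseChange ℚ).IsMinimalAt v) →
    (∀ p : ℕ, p.Prime → p ≠ 2 → ¬ p ^ 2 ∣ (W₀.baseChange ℚ).conductorNorm ℤ) →
    heightH W₀ ≤ K * condR W₀ ^ A →
    heightH W₀ ≤ C * (condR W₀ * tamWeight W₀) ^ (6 + ε)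

/-- **SlidingThin** — the quantifier-repaired thin statement (`δ` may depend on `ε`). -/
def SlidingThin : Prop :=
  ∀ ε : ℝ, 0 < ε → ∃ δ : ℝ, 0 < δ ∧ ∀ K : ℝ, ∃ C : ℝ, ∀ W₀ : WeierstrassCurve ℤ,
    (W₀.baseChange ℚ).IsElliptic →
    (∀ v : HeightOneSpectrum ℤ, (W₀.baseChange ℚ).IsMinimalAt v) →
    (∀ p : ℕ, p.Prime → p ≠ 2 → ¬ p ^ 2 ∣ (W₀.baseChange ℚ).conductorNorm ℤ) →
    (tamWeight W₀ : ℝ) ≤ K * condR W₀ ^ δ →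
    heightH W₀ ≤ C * (condR W₀ * tamWeight W₀) ^ (6 + ε)

/-- **FudgeFree B** — the crux with a FREE exponent `B` on the weight: `H ≤ C · N^{6+ε} · T^B`. -/
def FudgeFree (B : ℝ) : Prop :=
  ∃ θ : ℝ, 0 < θ ∧ ∀ ε : ℝ, 0 < ε → ∀ K : ℝ, ∃ C : ℝ, ∀ W₀ : WeierstrassCurve ℤ,
    (W₀.baseChange ℚ).IsElliptic →
    (∀ v : HeightOneSpectrum ℤ, (W₀.baseChange ℚ).IsMinimalAt v) →
    (∀ p : ℕ, p.Prime → p ≠ 2 → ¬ p ^ 2 ∣ (W₀.baseChange ℚ).conductorNorm ℤ) →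
    (tamWeight W₀ : ℝ) ≤ K * condR W₀ ^ θ →
    heightH W₀ ≤ C * condR W₀ ^ (6 + ε) * (tamWeight W₀ : ℝ) ^ B

/-! ## The glue (pure logic): PolyThinH ∧ Upgrade ⟹ crux -/

/-- **First lemma of the card.**  `PolyThinH θ A ∧ Upgrade A ⟹ r3″` with the SAME `θ`: given `ε, K`,
polynomial Szpiro on the `θ`-thin class puts every member in the window `H ≤ C₁(K) N^A`, where the
upgrade applies.  No divisor bound, no arithmetic. -/
theorem crux_of_polyThinH_of_upgrade {θ A : ℝ} (hθ : 0 < θ) (hP : PolyThinH θ A) (hU : Upgrade A) :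
    ThinWeightedSzpiro := by
  refine ⟨θ, hθ, fun ε hε K => ?_⟩
  obtain ⟨C₁, hC₁⟩ := hP K
  obtain ⟨C, hC⟩ := hU ε hε C₁
  exact ⟨C, fun W₀ hE hmin hss hthin => hC W₀ hE hmin hss (hC₁ W₀ hE hmin hss hthin)⟩

/-- `SlidingThin` is formally a consequence of the crux (`δ := θ` for every `ε`). -/
theorem sliding_of_crux (h : ThinWeightedSzpiro) : SlidingThin := by
  obtain ⟨θ, hθ, hθT⟩ := h
  intro ε hε
  exact ⟨θ, hθ, fun K => hθT ε hε K⟩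

/-! ## Standing facts about an admissible model -/

section facts

variable (W₀ : WeierstrassCurve ℤ)

variable {W₀} in
theorem condR_pos (hE : (W₀.baseChange ℚ).IsElliptic) : 0 < condR W₀ := by
  haveI := hE
  have := WeierstrassCurve.conductorNorm_pos_holds (W₀.baseChange ℚ)
  change 0 < (((W₀.baseChange ℚ).conductorNorm ℤ : ℕ) : ℝ)
  exact_mod_cast this

variable {W₀} in
theorem one_le_condR (hE : (W₀.baseChange ℚ).IsElliptic) : 1 ≤ condR W₀ := by
  haveI := hE
  have := WeierstrassCurve.conductorNorm_pos_holds (W₀.baseChange ℚ)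
  change (1 : ℝ) ≤ (((W₀.baseChange ℚ).conductorNorm ℤ : ℕ) : ℝ)
  exact_mod_cast this

theorem tamWeight_nonneg : (0 : ℝ) ≤ (tamWeight W₀ : ℝ) := Nat.cast_nonneg _

/-- `|Δ(W₀)| ≤ H`. -/
theorem natAbs_Δ_le_heightH : ((W₀.Δ.natAbs : ℕ) : ℝ) ≤ heightH W₀ := by
  change ((W₀.Δ.natAbs : ℕ) : ℝ) ≤ ((max |W₀.Δ| (|W₀.c₄| ^ 3) : ℤ) : ℝ)
  rw [Nat.cast_natAbs]
  exact Int.cast_le.mpr (le_max_left _ _)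

variable {W₀}

/-- For an elliptic `W₀`: `Δ(W₀) ≠ 0`. -/
theorem Δ_ne_zero (hE : (W₀.baseChange ℚ).IsElliptic) : W₀.Δ ≠ 0 := by
  intro h0
  apply hE.isUnit.ne_zero
  simp [WeierstrassCurve.baseChange, WeierstrassCurve.map_Δ, h0]

/-- `|Δ_min| = |Δ(W₀)|` on a global minimal model, hence `1 ≤ |Δ_min| ≤ H`. -/
theorem minDisc_le_heightH (hE : (W₀.baseChange ℚ).IsElliptic)
    (hmin : ∀ v : HeightOneSpectrum ℤ, (W₀.baseChange ℚ).IsMinimalAt v) :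
    (((W₀.baseChange ℚ).minimalDiscriminantNorm ℤ : ℕ) : ℝ) ≤ heightH W₀ := by
  rw [WeierstrassCurve.minimalDiscriminantNorm_eq_natAbs_holds W₀ (Δ_ne_zero hE) hmin]
  exact natAbs_Δ_le_heightH W₀

theorem one_le_heightH (hE : (W₀.baseChange ℚ).IsElliptic)
    (hmin : ∀ v : HeightOneSpectrum ℤ, (W₀.baseChange ℚ).IsMinimalAt v) : 1 ≤ heightH W₀ := by
  have hpos := WeierstrassCurve.minimalDiscriminantNorm_pos_holds (W₀.baseChange ℚ)
  have h1 : (1 : ℝ) ≤ (((W₀.baseChange ℚ).minimalDiscriminantNorm ℤ : ℕ) : ℝ) := by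
    exact_mod_cast hpos
  exact h1.trans (minDisc_le_heightH hE hmin)

/-- **Absorption of the weight**: `T ≤ K_η · H^η` for every `η > 0` (the landed divisor bound
`WeightedSzpiroBound.prod_factorization_le_rpow`, applied to `n = |Δ_min| ≤ H`). -/
theorem tamWeight_le_rpow_heightH {η : ℝ} (hη : 0 < η) :
    ∃ K : ℝ, 0 < K ∧ ∀ W₀ : WeierstrassCurve ℤ, (W₀.baseChange ℚ).IsElliptic →
      (∀ v : HeightOneSpectrum ℤ, (W₀.baseChange ℚ).IsMinimalAt v) →
      (tamWeight W₀ : ℝ) ≤ K * heightH W₀ ^ η := by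
  obtain ⟨K, hK, hKabs⟩ := WeightedSzpiroBound.prod_factorization_le_rpow hη
  refine ⟨K, hK, fun W₀ hE hmin => ?_⟩
  have hΔpos := WeierstrassCurve.minimalDiscriminantNorm_pos_holds (W₀.baseChange ℚ)
  have h1 := hKabs _ hΔpos (((W₀.baseChange ℚ).conductorNorm ℤ).primeFactors.filter
      (fun p ↦ ¬ p ^ 2 ∣ (W₀.baseChange ℚ).conductorNorm ℤ))
      (fun p hp ↦ Nat.prime_of_mem_primeFactors (Finset.mem_filter.mp hp).1)
  have h0 : (0 : ℝ) ≤ (((W₀.baseChange ℚ).minimalDiscriminantNorm ℤ : ℕ) : ℝ) := Nat.cast_nonneg _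
  exact h1.trans (mul_le_mul_of_nonneg_left
    (Real.rpow_le_rpow h0 (minDisc_le_heightH hE hmin) hη.le) hK.le)

end facts

/-! ## Converses: the crux implies both conjuncts -/

/-- r3″ ⟹ polynomial Szpiro on its own thin class, exponent `7(1+θ)` (take `ε = 1`). -/
theorem polyThinH_of_crux (h : ThinWeightedSzpiro) :
    ∃ θ : ℝ, 0 < θ ∧ PolyThinH θ (7 * (1 + θ)) := by
  obtain ⟨θ, hθ, hθT⟩ := h
  refine ⟨θ, hθ, fun K => ?_⟩
  obtain ⟨C, hC⟩ := hθT 1 one_pos K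
  set K₁ : ℝ := max K 1 with hK₁def
  have hK₁0 : 0 < K₁ := one_pos.trans_le (le_max_right _ _)
  refine ⟨max C 0 * K₁ ^ (7 : ℝ), fun W₀ hE hmin hss hthin => ?_⟩
  have key := hC W₀ hE hmin hss hthin
  have hNpos := condR_pos hE
  have hT0 := tamWeight_nonneg W₀
  have hNT0 : 0 ≤ condR W₀ * tamWeight W₀ := mul_nonneg hNpos.le hT0
  -- `T ≤ K N^θ ≤ K₁ N^θ`, so `N T ≤ K₁ N^{1+θ}`
  have hthin' : (tamWeight W₀ : ℝ) ≤ K₁ * condR W₀ ^ θ :=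
    hthin.trans (mul_le_mul_of_nonneg_right (le_max_left _ _) (Real.rpow_nonneg hNpos.le θ))
  have hNT : condR W₀ * tamWeight W₀ ≤ K₁ * condR W₀ ^ (1 + θ) := by
    calc condR W₀ * tamWeight W₀ ≤ condR W₀ * (K₁ * condR W₀ ^ θ) :=
          mul_le_mul_of_nonneg_left hthin' hNpos.le
      _ = K₁ * (condR W₀ ^ (1 : ℝ) * condR W₀ ^ θ) := by rw [Real.rpow_one]; ring
      _ = K₁ * condR W₀ ^ (1 + θ) := by rw [← Real.rpow_add hNpos]
  have h7 : (6 : ℝ) + 1 = 7 := by norm_num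
  calc heightH W₀ ≤ C * (condR W₀ * tamWeight W₀) ^ ((6 : ℝ) + 1) := key
    _ ≤ max C 0 * (condR W₀ * tamWeight W₀) ^ ((6 : ℝ) + 1) :=
        mul_le_mul_of_nonneg_right (le_max_left _ _) (Real.rpow_nonneg hNT0 _)
    _ ≤ max C 0 * (K₁ * condR W₀ ^ (1 + θ)) ^ ((6 : ℝ) + 1) :=
        mul_le_mul_of_nonneg_left (Real.rpow_le_rpow hNT0 hNT (by norm_num)) (le_max_right _ _)
    _ = max C 0 * K₁ ^ (7 : ℝ) * condR W₀ ^ (7 * (1 + θ)) := by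
        rw [h7, Real.mul_rpow hK₁0.le (Real.rpow_nonneg hNpos.le _), ← Real.rpow_mul hNpos.le]
        ring_nf

/-- r3″ ⟹ the exponent upgrade on EVERY polynomial window: a model with `H ≤ K N^A` is `θ`-thin with
`K' = K_η K^η`, `η = θ/A'` (`A' = max A 1`), by absorption. -/
theorem upgrade_of_crux (h : ThinWeightedSzpiro) (A : ℝ) : Upgrade A := by
  obtain ⟨θ, hθ, hθT⟩ := h
  intro ε hε K
  set A' : ℝ := max A 1 with hA'def
  have hA'1 : 1 ≤ A' := le_max_right _ _
  have hA'0 : 0 < A' := one_pos.trans_le hA'1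
  set η : ℝ := θ / A' with hηdef
  have hη : 0 < η := div_pos hθ hA'0
  have hAη : A' * η = θ := by rw [hηdef]; field_simp
  obtain ⟨K₀, hK₀, hK₀abs⟩ := tamWeight_le_rpow_heightH hη
  set K₁ : ℝ := max K 1 with hK₁def
  have hK₁0 : 0 < K₁ := one_pos.trans_le (le_max_right _ _)
  set K' : ℝ := K₀ * K₁ ^ η with hK'def
  obtain ⟨C, hC⟩ := hθT ε hε K'
  refine ⟨C, fun W₀ hE hmin hss hwin => hC W₀ hE hmin hss ?_⟩
  -- goal: `T ≤ K' N^θ`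
  have hNpos := condR_pos hE
  have hN1 := one_le_condR hE
  have hH0 : 0 ≤ heightH W₀ := zero_le_one.trans (one_le_heightH hE hmin)
  have hwin' : heightH W₀ ≤ K₁ * condR W₀ ^ A' := by
    calc heightH W₀ ≤ K * condR W₀ ^ A := hwin
      _ ≤ K₁ * condR W₀ ^ A :=
          mul_le_mul_of_nonneg_right (le_max_left _ _) (Real.rpow_nonneg hNpos.le A)
      _ ≤ K₁ * condR W₀ ^ A' :=
          mul_le_mul_of_nonneg_left (Real.rpow_le_rpow_of_exponent_le hN1 (le_max_left _ _)) hK₁0.le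
  have hT := hK₀abs W₀ hE hmin
  have e : (K₁ * condR W₀ ^ A') ^ η = K₁ ^ η * condR W₀ ^ θ := by
    rw [Real.mul_rpow hK₁0.le (Real.rpow_nonneg hNpos.le _), ← Real.rpow_mul hNpos.le, hAη]
  calc (tamWeight W₀ : ℝ) ≤ K₀ * heightH W₀ ^ η := hT
    _ ≤ K₀ * (K₁ * condR W₀ ^ A') ^ η :=
        mul_le_mul_of_nonneg_left (Real.rpow_le_rpow hH0 hwin' hη.le) hK₀.le
    _ = K' * condR W₀ ^ θ := by rw [e, hK'def]; ring
  -- (the change of goal above used only the divisor bound)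

/-- **The split is exact**: r3″ ⟺ ∃ θ > 0, ∃ A, PolyThinH θ A ∧ Upgrade A. -/
theorem crux_iff :
    ThinWeightedSzpiro ↔ ∃ θ : ℝ, 0 < θ ∧ ∃ A : ℝ, PolyThinH θ A ∧ Upgrade A := by
  constructor
  · intro h
    obtain ⟨θ, hθ, hP⟩ := polyThinH_of_crux h
    exact ⟨θ, hθ, 7 * (1 + θ), hP, upgrade_of_crux h _⟩
  · rintro ⟨θ, hθ, A, hP, hU⟩
    exact crux_of_polyThinH_of_upgrade hθ hP hU

/-! ## The fudge-free form -/

/-- r3″ ⟹ `FudgeFree 7` (`(N T)^{6+ε} = N^{6+ε} T^{6+ε} ≤ N^{6+ε} T^7` for `ε ≤ 1`, `T ≥ 1`). -/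
theorem fudgeFree_of_crux (h : ThinWeightedSzpiro) : FudgeFree 7 := by
  obtain ⟨θ, hθ, hθT⟩ := h
  refine ⟨θ, hθ, fun ε hε K => ?_⟩
  -- use the crux at `x = min ε 1`
  set x : ℝ := min ε 1 with hxdef
  have hx : 0 < x := lt_min hε one_pos
  have hx1 : x ≤ 1 := min_le_right _ _
  have hxε : x ≤ ε := min_le_left _ _
  obtain ⟨C, hC⟩ := hθT x hx K
  refine ⟨max C 0, fun W₀ hE hmin hss hthin => ?_⟩
  haveI := hE
  have key := hC W₀ hE hmin hss hthin
  have hNpos := condR_pos hE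
  have hN1 := one_le_condR hE
  have hT1 : (1 : ℝ) ≤ (tamWeight W₀ : ℝ) := by
    have := WeightedSzpiroBound.one_le_tamWeight (W₀.baseChange ℚ)
    change (1 : ℝ) ≤ ((tamWeight W₀ : ℕ) : ℝ)
    exact_mod_cast this
  have hT0 : (0 : ℝ) ≤ (tamWeight W₀ : ℝ) := zero_le_one.trans hT1
  have hNT0 : 0 ≤ condR W₀ * tamWeight W₀ := mul_nonneg hNpos.le hT0
  have h6x7 : 6 + x ≤ (7 : ℝ) := by linarith
  have h6xε : 6 + x ≤ 6 + ε := by linarith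
  calc heightH W₀ ≤ C * (condR W₀ * tamWeight W₀) ^ (6 + x) := key
    _ ≤ max C 0 * (condR W₀ * tamWeight W₀) ^ (6 + x) :=
        mul_le_mul_of_nonneg_right (le_max_left _ _) (Real.rpow_nonneg hNT0 _)
    _ = max C 0 * (condR W₀ ^ (6 + x) * (tamWeight W₀ : ℝ) ^ (6 + x)) := by
        rw [Real.mul_rpow hNpos.le hT0]
    _ ≤ max C 0 * (condR W₀ ^ (6 + ε) * (tamWeight W₀ : ℝ) ^ (7 : ℝ)) := by
        apply mul_le_mul_of_nonneg_left _ (le_max_right _ _)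
        exact mul_le_mul (Real.rpow_le_rpow_of_exponent_le hN1 h6xε)
          (Real.rpow_le_rpow_of_exponent_le hT1 h6x7) (Real.rpow_nonneg hT0 _)
          (Real.rpow_nonneg hNpos.le _)
    _ = max C 0 * condR W₀ ^ (6 + ε) * (tamWeight W₀ : ℝ) ^ (7 : ℝ) := by ring

/-- `FudgeFree B ⟹ r3″` for EVERY `B`: a free power of the weight is absorbed (`T^B ≤ K^B N^{Bθ}`
gives the polynomial window, then `T ≤ K_η H^η` makes `T^B ≤ N^{ε}`-cheap).  Proof: via `crux_iff`. -/
theorem crux_of_fudgeFree {B : ℝ} (hB : 0 ≤ B) (h : FudgeFree B) : ThinWeightedSzpiro := by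
  obtain ⟨θ, hθ, hθT⟩ := h
  -- (1) PolyThinH θ (7 + B θ)
  have hP : PolyThinH θ (7 + B * θ) := by
    intro K
    obtain ⟨C, hC⟩ := hθT 1 one_pos K
    set K₁ : ℝ := max K 1 with hK₁def
    have hK₁0 : 0 < K₁ := one_pos.trans_le (le_max_right _ _)
    refine ⟨max C 0 * K₁ ^ B, fun W₀ hE hmin hss hthin => ?_⟩
    have key := hC W₀ hE hmin hss hthin
    have hNpos := condR_pos hE
    have hN1 := one_le_condR hE
    have hT0 := tamWeight_nonneg W₀
    have hthin' : (tamWeight W₀ : ℝ) ≤ K₁ * condR W₀ ^ θ :=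
      hthin.trans (mul_le_mul_of_nonneg_right (le_max_left _ _) (Real.rpow_nonneg hNpos.le θ))
    have hTB : (tamWeight W₀ : ℝ) ^ B ≤ K₁ ^ B * condR W₀ ^ (B * θ) := by
      calc (tamWeight W₀ : ℝ) ^ B ≤ (K₁ * condR W₀ ^ θ) ^ B := Real.rpow_le_rpow hT0 hthin' hB
        _ = K₁ ^ B * condR W₀ ^ (B * θ) := by
            rw [Real.mul_rpow hK₁0.le (Real.rpow_nonneg hNpos.le _), ← Real.rpow_mul hNpos.le,
              mul_comm θ B]
    have h67 : (6 : ℝ) + 1 = 7 := by norm_num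
    calc heightH W₀ ≤ C * condR W₀ ^ ((6 : ℝ) + 1) * (tamWeight W₀ : ℝ) ^ B := key
      _ ≤ max C 0 * condR W₀ ^ ((6 : ℝ) + 1) * (tamWeight W₀ : ℝ) ^ B := by
          apply mul_le_mul_of_nonneg_right _ (Real.rpow_nonneg hT0 _)
          exact mul_le_mul_of_nonneg_right (le_max_left _ _) (Real.rpow_nonneg hNpos.le _)
      _ ≤ max C 0 * condR W₀ ^ ((6 : ℝ) + 1) * (K₁ ^ B * condR W₀ ^ (B * θ)) :=
          mul_le_mul_of_nonneg_left hTB (mul_nonneg (le_max_right _ _) (Real.rpow_nonneg hNpos.le _))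
      _ = max C 0 * K₁ ^ B * (condR W₀ ^ ((6 : ℝ) + 1) * condR W₀ ^ (B * θ)) := by ring
      _ = max C 0 * K₁ ^ B * condR W₀ ^ (7 + B * θ) := by rw [← Real.rpow_add hNpos, h67]
  -- (2) Upgrade (7 + B θ): on the window, T ≤ K_η H^η is cheap
  have hU : Upgrade (7 + B * θ) := by
    intro ε hε K
    set A : ℝ := 7 + B * θ with hAdef
    have hA0 : 0 < A := by have := mul_nonneg hB hθ.le; linarith
    -- absorption exponent: B' η A = ε/2 with B' = max B 1
    set B' : ℝ := max B 1 with hB'def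
    have hB'0 : 0 < B' := one_pos.trans_le (le_max_right _ _)
    set η : ℝ := ε / (2 * B' * A) with hηdef
    have hη : 0 < η := by positivity
    obtain ⟨K₀, hK₀, hK₀abs⟩ := tamWeight_le_rpow_heightH hη
    set K₁ : ℝ := max K 1 with hK₁def
    have hK₁0 : 0 < K₁ := one_pos.trans_le (le_max_right _ _)
    -- thinness constant on the window: T ≤ K₀ (K₁ N^A)^η = K₀ K₁^η N^{Aη} ≤ K' N^θ? No: we feed the
    -- fudge-free bound directly at level θ' := A η... but `hθT` is at the FROZEN θ.  So instead:
    -- T ≤ K₀ K₁^η N^{Aη}; we need T ≤ K'' N^θ to apply hθT: true iff A η ≤ θ, arranged below by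
    -- shrinking η further (η ≤ θ / A).
    set η' : ℝ := min η (θ / A) with hη'def
    have hη' : 0 < η' := lt_min hη (div_pos hθ hA0)
    have hη'η : η' ≤ η := min_le_left _ _
    have hη'θ : A * η' ≤ θ := by
      have : η' ≤ θ / A := min_le_right _ _
      calc A * η' ≤ A * (θ / A) := mul_le_mul_of_nonneg_left this hA0.le
        _ = θ := by field_simp
    obtain ⟨K₀', hK₀', hK₀'abs⟩ := tamWeight_le_rpow_heightH hη'
    set K'' : ℝ := K₀' * K₁ ^ η' with hK''def
    obtain ⟨C, hC⟩ := hθT (ε / 2) (half_pos hε) K''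
    refine ⟨max C 0 * (K₀' * K₁ ^ η') ^ B, fun W₀ hE hmin hss hwin => ?_⟩
    have hNpos := condR_pos hE
    have hN1 := one_le_condR hE
    have hH1 := one_le_heightH hE hmin
    have hH0 : 0 ≤ heightH W₀ := zero_le_one.trans hH1
    have hT0 := tamWeight_nonneg W₀
    have hT1 : (1 : ℝ) ≤ (tamWeight W₀ : ℝ) := by
      haveI := hE
      have := WeightedSzpiroBound.one_le_tamWeight (W₀.baseChange ℚ)
      change (1 : ℝ) ≤ ((tamWeight W₀ : ℕ) : ℝ)
      exact_mod_cast this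
    have hwin' : heightH W₀ ≤ K₁ * condR W₀ ^ A :=
      hwin.trans (mul_le_mul_of_nonneg_right (le_max_left _ _) (Real.rpow_nonneg hNpos.le A))
    -- T ≤ K₀' H^{η'} ≤ K₀' K₁^{η'} N^{A η'} ≤ K'' N^θ
    have hTθ : (tamWeight W₀ : ℝ) ≤ K'' * condR W₀ ^ θ := by
      calc (tamWeight W₀ : ℝ) ≤ K₀' * heightH W₀ ^ η' := hK₀'abs W₀ hE hmin
        _ ≤ K₀' * (K₁ * condR W₀ ^ A) ^ η' :=
            mul_le_mul_of_nonneg_left (Real.rpow_le_rpow hH0 hwin' hη'.le) hK₀'.le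
        _ = K₀' * K₁ ^ η' * condR W₀ ^ (A * η') := by
            rw [Real.mul_rpow hK₁0.le (Real.rpow_nonneg hNpos.le _), ← Real.rpow_mul hNpos.le]; ring
        _ ≤ K₀' * K₁ ^ η' * condR W₀ ^ θ :=
            mul_le_mul_of_nonneg_left (Real.rpow_le_rpow_of_exponent_le hN1 hη'θ)
              (mul_nonneg hK₀'.le (Real.rpow_nonneg hK₁0.le _))
        _ = K'' * condR W₀ ^ θ := by rw [hK''def]
    have key := hC W₀ hE hmin hss hTθ
    -- T^B ≤ (K'' N^θ ... ) no: use T ≤ K₀' K₁^{η'} N^{Aη'} and A η' B ≤ ... we need T^B ≤ c N^{ε/2}.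
    -- From T ≤ K₀' K₁^{η'} N^{A η'} and A η' ≤ A η = ε/(2B') ≤ ε/(2B) (if B ≥ 1) — handle B < 1 via B'.
    have hTpoly : (tamWeight W₀ : ℝ) ≤ K₀' * K₁ ^ η' * condR W₀ ^ (A * η') := by
      calc (tamWeight W₀ : ℝ) ≤ K₀' * heightH W₀ ^ η' := hK₀'abs W₀ hE hmin
        _ ≤ K₀' * (K₁ * condR W₀ ^ A) ^ η' :=
            mul_le_mul_of_nonneg_left (Real.rpow_le_rpow hH0 hwin' hη'.le) hK₀'.le
        _ = K₀' * K₁ ^ η' * condR W₀ ^ (A * η') := by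
            rw [Real.mul_rpow hK₁0.le (Real.rpow_nonneg hNpos.le _), ← Real.rpow_mul hNpos.le]; ring
    have hc0 : 0 ≤ K₀' * K₁ ^ η' := mul_nonneg hK₀'.le (Real.rpow_nonneg hK₁0.le _)
    have hexpB : A * η' * B ≤ ε / 2 := by
      have h1 : A * η' * B ≤ A * η * B' := by
        have := mul_le_mul (mul_le_mul_of_nonneg_left hη'η hA0.le) (le_max_left B 1)
          hB (mul_nonneg hA0.le hη.le)
        simpa [hB'def] using this
      have h2 : A * η * B' = ε / 2 := by rw [hηdef]; field_simp
      linarith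
    have hTB : (tamWeight W₀ : ℝ) ^ B ≤ (K₀' * K₁ ^ η') ^ B * condR W₀ ^ (ε / 2) := by
      calc (tamWeight W₀ : ℝ) ^ B ≤ (K₀' * K₁ ^ η' * condR W₀ ^ (A * η')) ^ B :=
            Real.rpow_le_rpow hT0 hTpoly hB
        _ = (K₀' * K₁ ^ η') ^ B * condR W₀ ^ (A * η' * B) := by
            rw [Real.mul_rpow hc0 (Real.rpow_nonneg hNpos.le _), ← Real.rpow_mul hNpos.le]
        _ ≤ (K₀' * K₁ ^ η') ^ B * condR W₀ ^ (ε / 2) :=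
            mul_le_mul_of_nonneg_left (Real.rpow_le_rpow_of_exponent_le hN1 hexpB)
              (Real.rpow_nonneg hc0 _)
    -- assemble: H ≤ C N^{6+ε/2} T^B ≤ max C 0 · (K₀'K₁^{η'})^B · N^{6+ε} ≤ … · (N T)^{6+ε}
    have hNT1 : condR W₀ ≤ condR W₀ * tamWeight W₀ := le_mul_of_one_le_right hNpos.le hT1
    have hNT0 : 0 ≤ condR W₀ * tamWeight W₀ := mul_nonneg hNpos.le hT0
    have h6ε : (0 : ℝ) ≤ 6 + ε := by linarith
    calc heightH W₀ ≤ C * condR W₀ ^ (6 + ε / 2) * (tamWeight W₀ : ℝ) ^ B := key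
      _ ≤ max C 0 * condR W₀ ^ (6 + ε / 2) * (tamWeight W₀ : ℝ) ^ B := by
          apply mul_le_mul_of_nonneg_right _ (Real.rpow_nonneg hT0 _)
          exact mul_le_mul_of_nonneg_right (le_max_left _ _) (Real.rpow_nonneg hNpos.le _)
      _ ≤ max C 0 * condR W₀ ^ (6 + ε / 2) * ((K₀' * K₁ ^ η') ^ B * condR W₀ ^ (ε / 2)) :=
          mul_le_mul_of_nonneg_left hTB (mul_nonneg (le_max_right _ _) (Real.rpow_nonneg hNpos.le _))
      _ = max C 0 * (K₀' * K₁ ^ η') ^ B * (condR W₀ ^ (6 + ε / 2) * condR W₀ ^ (ε / 2)) := by ring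
      _ = max C 0 * (K₀' * K₁ ^ η') ^ B * condR W₀ ^ (6 + ε) := by
          rw [← Real.rpow_add hNpos]; ring_nf
      _ ≤ max C 0 * (K₀' * K₁ ^ η') ^ B * (condR W₀ * tamWeight W₀) ^ (6 + ε) :=
          mul_le_mul_of_nonneg_left (Real.rpow_le_rpow hNpos.le hNT1 h6ε)
            (mul_nonneg (le_max_right _ _) (Real.rpow_nonneg hc0 _))
  exact crux_of_polyThinH_of_upgrade hθ hP hU

/-! ## Research statement for `stub_polyThinH` on Frey models: uniform Ridout, simply-exponential in `|S|`

`UniformRidoutExp` (URE): there are `κ > 0` and `C₀` such that for EVERY finite set of primes `S` and every abc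
triple, `c^κ ≤ C₀^{|S|} · (∏_{p ∈ S} p) · {abc}^S`, where `{abc}^S = abc / ∏_{p∈S} p^{v_p(abc)}` is the `S`-free
part.  Per `S` (ineffective constant, `κ = 1 − ε`) this is Ridout's theorem in abc form (Vojta 1987 Thm 2.1.1);
abc gives it with `κ = 1 − ε`, `C₀ = C_ε`; the uniform-in-`S`, some-exponent form is what `PolyThinH` needs on the
minimal Frey models of thin triples (powerful support `S`, `|S| ≤ log₂ T ≤ θ log₂ N + log₂ K`, and `{abc}^S`
squarefree there, so `(∏_{p∈S} p)·{abc}^S ≤ rad(abc)`): `c ≤ (C₀^{|S|} rad)^{1/κ} ≤ K' · rad^{(1 + θ log₂ C₀)/κ}`. -/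
def UniformRidoutExp : Prop :=
  ∃ κ : ℝ, 0 < κ ∧ ∃ C₀ : ℝ, ∀ S : Finset ℕ, (∀ p ∈ S, p.Prime) →
    ∀ a b c : ℕ, Literature.NumberTheory.DiophantineGeometry.IsABCTriple a b c →
      (c : ℝ) ^ κ ≤ C₀ ^ S.card * ((∏ p ∈ S, p : ℕ) : ℝ) *
        (((a * b * c) / ∏ p ∈ S, p ^ (a * b * c).factorization p : ℕ) : ℝ)

/-- Polynomial abc on triples with powerful support of logarithmic size (the Frey face of `PolyThinH`):
for some `θ > 0` and `A`, every abc triple whose primes `p` with `p² ∣ abc` number at most `θ log₂ rad + K`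
satisfies `c ≤ C(K) · rad^A`. -/
def PolyAbcLogSupport : Prop :=
  ∃ θ : ℝ, 0 < θ ∧ ∃ A : ℝ, ∀ K : ℝ, ∃ C : ℝ, ∀ a b c : ℕ,
    Literature.NumberTheory.DiophantineGeometry.IsABCTriple a b c →
    ((((a * b * c).primeFactors.filter (fun p => p ^ 2 ∣ a * b * c)).card : ℕ) : ℝ) ≤
      θ * Real.logb 2 (Literature.NumberTheory.DiophantineGeometry.rad a b c) + K →
    (c : ℝ) ≤ C * ((Literature.NumberTheory.DiophantineGeometry.rad a b c : ℕ) : ℝ) ^ A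

end Summit.ABC.ABC.Cruxes.ThinWeightedSzpiro.SelfImprovement

end
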